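import Mathlib.MeasureTheory.Integral.IntervalIntegral.Periodic
import Mathlib.MeasureTheory.Integral.IntervalIntegral.IntegrationByParts
import Mathlib.Analysis.SpecialFunctions.Integrals.Basic
import Mathlib.Algebra.QuadraticDiscriminant
import HarnessLib

/-!
# FunctionalMining / NoGo — one-variable tools for the VECTOR-LAMINATE heat-coercivity of `∫(λ₁⁺)^q`,
# every real `q > 1` (door (c), node K6, Lemma L-λ(q); file 1 of 3: the periodic sup bound)

search for candidate a priori estimates; no regularity claim. Cell `pub-nsfunc`, nogo seat (gen 47),
file K38a. Elementary real analysis on the period `[0, 1]`; nothing about Navier–Stokes dynamics.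

For a general laminate `u(x) = A(k·x)` (`TopEigLaminateRigid`) the strain eigenvalue is
`λ₁ = |A′(k·x)|·|k|/2` with the VECTOR profile `A′ = (A₀′, A₁′, A₂′)`; unlike the `x₂`-laminates of K37
(`NoGo/TopEigHeatLaminateDirichlet`, `…Wirtinger`), `|A′|` need not vanish anywhere, so K37ʼs Dirichlet
anchor is unavailable for `1 < q < 2`.  Its replacement (file 2, `TopEigHeatVectorLaminateMean`) is a
MEAN-DEFECT argument resting on the tools of this file:
* `sq_integral_mul_le` — Cauchy–Schwarz `(∫₀¹fg)² ≤ ∫₀¹f²·∫₀¹g²` (discriminant);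
* `sub_mean_eq_integral_kernel` — for a `C¹` `1`-periodic `u`: `u(s) − ∫₀¹u = ∫₀¹ (r − ½)·u′(s + r) dr`, and the
  **SUP BOUND `sq_sub_mean_le`: `(u(s) − ∫₀¹u)² ≤ (1/12)·∫₀¹u′²`** for every `s` (`∫₀¹(r − ½)² = 1/12`);
* `exists_eq_zero_of_integral_eq_zero` — a continuous `f` with `∫₀¹ f = 0` has a zero;
* two pointwise inequalities (§2) used on the integrands of file 2: `ibp_integrand_lower`
  (`min(1,1+2β)(W+e)D ≤ (W+e)D + 2βX²` when `X² ≤ WD`) and `deriv_sq_upper`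
  (`4γ²X²W + 4γX²w + w²D ≤ max(1,(1+2γ)²)w²D` when `X² ≤ WD`, `W ≤ w`, `γ > −1`);
* `tangent_sumSq_rpow` (§3) — the tangent inequality of the convex `x ↦ |x|^q` on `ℝ³` in coordinates,
  `(Σaᵢ²)^{q/2} + q(Σaᵢ²)^{(q−2)/2}Σaᵢ(pᵢ − aᵢ) ≤ (Σpᵢ²)^{q/2}` (`q ≥ 1`; Bernoulli + Cauchy–Schwarz), used in
  file 3 (`TopEigHeatVectorLaminate`) to squeeze the right derivative of the heat line.
[folklore tools; ours = bookkeeping] search for candidate a priori estimates; no regularity claim.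
FILING (prove seat g28, REQUEST #57): declarations byte-identical to the no-go seat's staged `TopEigHeatPeriodicMean.STAGING.lean` 59b866234d9be4df; this line is the only addition.
-/

noncomputable section

open MeasureTheory Set intervalIntegral Real

namespace Summit.NavierStokesRegularity.FunctionalMining

namespace TopEigLaminate

/-! ## 1. Generic one-variable tools on the period `[0, 1]` -/

/-- Cauchy–Schwarz for `∫₀¹`: `(∫₀¹ fg)² ≤ ∫₀¹f² · ∫₀¹g²` (continuous `f, g`; discriminant argument). [folklore] -/
theorem sq_integral_mul_le {f g : ℝ → ℝ} (hf : Continuous f) (hg : Continuous g) :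
    (∫ x in (0 : ℝ)..1, f x * g x) ^ 2 ≤ (∫ x in (0 : ℝ)..1, f x ^ 2) * ∫ x in (0 : ℝ)..1, g x ^ 2 := by
  have hq : ∀ y : ℝ, 0 ≤ (∫ x in (0 : ℝ)..1, f x ^ 2) * (y * y) + (2 * ∫ x in (0 : ℝ)..1, f x * g x) * y +
      ∫ x in (0 : ℝ)..1, g x ^ 2 := by
    intro y
    have i1 : IntervalIntegrable (fun x => y * y * f x ^ 2) volume 0 1 :=
      (continuous_const.mul (hf.pow 2)).intervalIntegrable _ _
    have i2 : IntervalIntegrable (fun x => 2 * y * (f x * g x)) volume 0 1 :=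
      (continuous_const.mul (hf.mul hg)).intervalIntegrable _ _
    have i3 : IntervalIntegrable (fun x => g x ^ 2) volume 0 1 := (hg.pow 2).intervalIntegrable _ _
    have h : ∫ x in (0 : ℝ)..1, (y * f x + g x) ^ 2 = (∫ x in (0 : ℝ)..1, f x ^ 2) * (y * y) +
        (2 * ∫ x in (0 : ℝ)..1, f x * g x) * y + ∫ x in (0 : ℝ)..1, g x ^ 2 := by
      have e : ∀ x, (y * f x + g x) ^ 2 = y * y * f x ^ 2 + 2 * y * (f x * g x) + g x ^ 2 := fun x => by ring
      simp_rw [e]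
      rw [intervalIntegral.integral_add (i1.add i2) i3, intervalIntegral.integral_add i1 i2,
        intervalIntegral.integral_const_mul, intervalIntegral.integral_const_mul]
      ring
    rw [← h]
    exact intervalIntegral.integral_nonneg zero_le_one fun x _ => sq_nonneg _
  have hd := discrim_le_zero hq
  rw [discrim] at hd
  nlinarith [hd]

/-- `∫₀¹ (u(r) − ∫₀¹u)² = ∫₀¹ u² − (∫₀¹ u)²`. [folklore; bookkeeping] -/
theorem integral_sq_sub_mean {u : ℝ → ℝ} (hu : Continuous u) :
    ∫ r in (0 : ℝ)..1, (u r - ∫ x in (0 : ℝ)..1, u x) ^ 2 =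
      (∫ r in (0 : ℝ)..1, u r ^ 2) - (∫ x in (0 : ℝ)..1, u x) ^ 2 := by
  set m := ∫ x in (0 : ℝ)..1, u x
  have i1 : IntervalIntegrable (fun r => u r ^ 2) volume 0 1 := (hu.pow 2).intervalIntegrable _ _
  have i2 : IntervalIntegrable (fun r => 2 * m * u r) volume 0 1 := (continuous_const.mul hu).intervalIntegrable _ _
  have i3 : IntervalIntegrable (fun _ => m ^ 2) volume (0 : ℝ) 1 := intervalIntegrable_const
  have e : ∀ r, (u r - m) ^ 2 = u r ^ 2 - 2 * m * u r + m ^ 2 := fun r => by ring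
  simp_rw [e]
  rw [intervalIntegral.integral_add (i1.sub i2) i3, intervalIntegral.integral_sub i1 i2,
    intervalIntegral.integral_const_mul, intervalIntegral.integral_const]
  simp only [sub_zero, smul_eq_mul, one_mul]
  ring

/-- **Kernel identity** for a `C¹` `1`-periodic `u`: `u(s) − ∫₀¹u = ∫₀¹ (r − ½)·u′(s + r) dr`. [folklore] -/
theorem sub_mean_eq_integral_kernel {u u' : ℝ → ℝ} (hper : Function.Periodic u 1)
    (hd : ∀ x, HasDerivAt u (u' x) x) (hc : Continuous u') (s : ℝ) :
    u s - ∫ r in (0 : ℝ)..1, u r = ∫ r in (0 : ℝ)..1, (r - 1 / 2) * u' (s + r) := by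
  have hcu : Continuous u := continuous_iff_continuousAt.2 fun x => (hd x).continuousAt
  have hV : ∀ r, HasDerivAt (fun r => u (s + r)) (u' (s + r)) r := fun r => HasDerivAt.comp_const_add s r (hd (s + r))
  have hU : ∀ r : ℝ, HasDerivAt (fun r : ℝ => r - 1 / 2) 1 r := fun r => (hasDerivAt_id r).sub_const _
  have h := intervalIntegral.integral_mul_deriv_eq_deriv_mul (a := 0) (b := 1) (u := fun r : ℝ => r - 1 / 2)
    (v := fun r => u (s + r)) (u' := fun _ => (1 : ℝ)) (v' := fun r => u' (s + r)) (fun r _ => hU r) (fun r _ => hV r)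
    intervalIntegrable_const ((hc.comp (continuous_const.add continuous_id)).intervalIntegrable _ _)
  have hshift : ∫ r in (0 : ℝ)..1, u (s + r) = ∫ r in (0 : ℝ)..1, u r := by
    rw [intervalIntegral.integral_comp_add_left u s]
    simp only [add_zero]
    have := hper.intervalIntegral_add_eq s 0
    rw [zero_add] at this
    exact this
  rw [h, hper s]
  simp only [add_zero, one_mul, hshift]
  ring

/-- **Sup bound** for a `C¹` `1`-periodic `u`: `(u(s) − ∫₀¹u)² ≤ (1/12)·∫₀¹ u′²` (kernel identity and
Cauchy–Schwarz, `∫₀¹(r − ½)² = 1/12`). [folklore] -/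
theorem sq_sub_mean_le {u u' : ℝ → ℝ} (hper : Function.Periodic u 1) (hper' : Function.Periodic u' 1)
    (hd : ∀ x, HasDerivAt u (u' x) x) (hc : Continuous u') (s : ℝ) :
    (u s - ∫ r in (0 : ℝ)..1, u r) ^ 2 ≤ 1 / 12 * ∫ r in (0 : ℝ)..1, u' r ^ 2 := by
  rw [sub_mean_eq_integral_kernel hper hd hc s]
  have hK : ∫ r in (0 : ℝ)..1, (r - 1 / 2) ^ 2 = 1 / 12 := by
    rw [intervalIntegral.integral_comp_sub_right (fun x : ℝ => x ^ 2) (1 / 2 : ℝ), integral_pow]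
    norm_num
  have hshift : ∫ r in (0 : ℝ)..1, u' (s + r) ^ 2 = ∫ r in (0 : ℝ)..1, u' r ^ 2 := by
    have hp2 : Function.Periodic (fun x => u' x ^ 2) 1 := fun x => by simp only [hper' x]
    rw [intervalIntegral.integral_comp_add_left (fun x => u' x ^ 2) s]
    simp only [add_zero]
    have := hp2.intervalIntegral_add_eq s 0
    rw [zero_add] at this
    exact this
  have hcs := sq_integral_mul_le (f := fun r : ℝ => r - 1 / 2) (g := fun r => u' (s + r))
    (continuous_id.sub continuous_const) (hc.comp (continuous_const.add continuous_id))
  rw [hK, hshift] at hcs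
  exact hcs

/-- A continuous function with zero integral over `[0, 1]` has a zero. [folklore] -/
theorem exists_eq_zero_of_integral_eq_zero {f : ℝ → ℝ} (hf : Continuous f)
    (h0 : ∫ x in (0 : ℝ)..1, f x = 0) : ∃ s, f s = 0 := by
  by_contra h
  push Not at h
  have key : ∀ g : ℝ → ℝ, Continuous g → (∀ s, g s ≠ 0) → g 0 < 0 → ∫ x in (0 : ℝ)..1, g x < 0 := by
    intro g hg hne hg0
    have hall : ∀ s, g s < 0 := fun s => by
      by_contra hs
      push Not at hs
      obtain ⟨c, hc⟩ := intermediate_value_univ 0 s hg ⟨hg0.le, hs⟩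
      exact hne c hc
    have hp := intervalIntegral.intervalIntegral_pos_of_pos (f := fun x => -g x) (hg.neg.intervalIntegrable 0 1)
      (fun x => neg_pos.2 (hall x)) zero_lt_one
    rw [intervalIntegral.integral_neg] at hp
    linarith
  rcases lt_or_gt_of_ne (h 0) with h0n | h0p
  · linarith [key f hf h h0n]
  · have h1 := key (fun x => -f x) hf.neg (fun s => neg_ne_zero.2 (h s)) (neg_neg_of_pos h0p)
    rw [intervalIntegral.integral_neg] at h1
    linarith

/-! ## 2. Pointwise algebra -/

/-- IBP-integrand lower bound: `min(1, 1+2β)·(W+e)D ≤ (W+e)D + 2βX²` when `X² ≤ WD`, `W, D, e ≥ 0`. [ours;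
bookkeeping] -/
theorem ibp_integrand_lower {W D X e β : ℝ} (hD : 0 ≤ D) (hX : X ^ 2 ≤ W * D) (he : 0 ≤ e) :
    min 1 (1 + 2 * β) * ((W + e) * D) ≤ (W + e) * D + 2 * β * X ^ 2 := by
  rcases le_or_gt 0 β with hb | hb
  · rw [min_eq_left (by linarith)]
    nlinarith [sq_nonneg X]
  · rw [min_eq_right (by linarith)]
    have h1 : X ^ 2 - (W + e) * D ≤ 0 := by nlinarith [mul_nonneg he hD]
    nlinarith [mul_nonneg_of_nonpos_of_nonpos h1 hb.le]

/-- Derivative-side upper bound: `4γ²X²W + 4γX²w + w²D ≤ max(1,(1+2γ)²)·w²D` when `X² ≤ WD`, `0 ≤ W ≤ w`,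
`D ≥ 0`, `γ > −1`. [ours; bookkeeping] -/
theorem deriv_sq_upper {W D X w γ : ℝ} (hW : 0 ≤ W) (hD : 0 ≤ D) (hX : X ^ 2 ≤ W * D) (hw : W ≤ w)
    (hγ : -1 < γ) :
    4 * γ ^ 2 * X ^ 2 * W + 4 * γ * X ^ 2 * w + w ^ 2 * D ≤ max 1 ((1 + 2 * γ) ^ 2) * (w ^ 2 * D) := by
  have hw0 : 0 ≤ w := hW.trans hw
  have hXw : X ^ 2 ≤ w * D := hX.trans (mul_le_mul_of_nonneg_right hw hD)
  rcases le_or_gt 0 γ with hg | hg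
  · rw [max_eq_right (by nlinarith)]
    have h1 : X ^ 2 * W ≤ w ^ 2 * D := by nlinarith [mul_le_mul hXw hw hW (mul_nonneg hw0 hD)]
    have h2 : X ^ 2 * w ≤ w ^ 2 * D := by nlinarith [mul_le_mul_of_nonneg_right hXw hw0]
    nlinarith [mul_le_mul_of_nonneg_left h1 (by positivity : (0 : ℝ) ≤ 4 * γ ^ 2),
      mul_le_mul_of_nonneg_left h2 (by positivity : (0 : ℝ) ≤ 4 * γ)]
  · rw [max_eq_left (by nlinarith)]
    have h1 : 4 * γ ^ 2 * X ^ 2 * W ≤ 4 * γ ^ 2 * X ^ 2 * w := by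
      have := mul_le_mul_of_nonneg_left hw (by positivity : (0 : ℝ) ≤ 4 * γ ^ 2 * X ^ 2); linarith
    have h2 : 0 ≤ X ^ 2 * w * (-(γ * (1 + γ))) :=
      mul_nonneg (mul_nonneg (sq_nonneg X) hw0) (by nlinarith)
    nlinarith [h1, h2]

/-! ## 3. The vector tangent inequality of `x ↦ |x|^q` in coordinates -/

/-- **Tangent inequality of the convex function `x ↦ |x|^q` on `ℝ³`, `q ≥ 1`, in coordinates**:
`|a|^q + q|a|^{q−2}⟨a, p − a⟩ ≤ |p|^q`, written with `|a|² = Σaᵢ²` (Bernoulli's inequality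
`1 + qs ≤ (1 + s)^q` at `s = |p|/|a| − 1` and Cauchy–Schwarz). [folklore] -/
theorem tangent_sumSq_rpow {q : ℝ} (hq : 1 ≤ q) (a p : Fin 3 → ℝ) :
    (∑ i, a i ^ 2) ^ (q / 2) + q * (∑ i, a i ^ 2) ^ ((q - 2) / 2) * ∑ i, a i * (p i - a i) ≤
      (∑ i, p i ^ 2) ^ (q / 2) := by
  have hW : 0 ≤ ∑ i, a i ^ 2 := Finset.sum_nonneg fun i _ => sq_nonneg _
  have hV : 0 ≤ ∑ i, p i ^ 2 := Finset.sum_nonneg fun i _ => sq_nonneg _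
  have hcs : ∑ i, a i * p i ≤ Real.sqrt (∑ i, a i ^ 2) * Real.sqrt (∑ i, p i ^ 2) :=
    Real.sum_mul_le_sqrt_mul_sqrt _ _ _
  have hdot : ∑ i, a i * (p i - a i) = (∑ i, a i * p i) - ∑ i, a i ^ 2 := by
    rw [← Finset.sum_sub_distrib]; exact Finset.sum_congr rfl fun i _ => by ring
  set α := Real.sqrt (∑ i, a i ^ 2) with hα
  set ϖ := Real.sqrt (∑ i, p i ^ 2) with hϖ
  have hα0 : 0 ≤ α := Real.sqrt_nonneg _
  have hϖ0 : 0 ≤ ϖ := Real.sqrt_nonneg _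
  have hαsq : α ^ 2 = ∑ i, a i ^ 2 := Real.sq_sqrt hW
  have hϖsq : ϖ ^ 2 = ∑ i, p i ^ 2 := Real.sq_sqrt hV
  have hpow : ∀ {x : ℝ} (r : ℝ), 0 ≤ x → (x ^ 2) ^ r = x ^ (2 * r) := fun r hx => by
    rw [← Real.rpow_natCast, ← Real.rpow_mul hx]; norm_num
  rw [hdot, ← hαsq, ← hϖsq, hpow _ hα0, hpow _ hα0, hpow _ hϖ0,
    show 2 * (q / 2) = q by ring, show 2 * ((q - 2) / 2) = q - 2 by ring]
  have hq0 : 0 < q := by linarith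
  rcases hα0.eq_or_lt with h0 | hpos
  · -- `a = 0`
    rw [← h0] at hcs ⊢
    have h1 : (0 : ℝ) ^ q = 0 := Real.zero_rpow hq0.ne'
    have h2 : q * (0 : ℝ) ^ (q - 2) * ((∑ i, a i * p i) - (0 : ℝ) ^ 2) ≤ 0 := by
      have : (∑ i, a i * p i) - (0 : ℝ) ^ 2 ≤ 0 := by simpa using hcs
      exact mul_nonpos_of_nonneg_of_nonpos (mul_nonneg hq0.le (Real.rpow_nonneg le_rfl _)) this
    have h3 : 0 ≤ ϖ ^ q := Real.rpow_nonneg hϖ0 _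
    linarith
  · -- `a ≠ 0`: Bernoulli at `s = |p|/|a| − 1`
    have hX : (∑ i, a i * p i) - α ^ 2 ≤ α * (ϖ - α) := by nlinarith [hcs]
    have hmid : q * α ^ (q - 2) * ((∑ i, a i * p i) - α ^ 2) ≤ q * α ^ (q - 1) * (ϖ - α) := by
      have e : α ^ (q - 1) = α ^ (q - 2) * α := by
        rw [← Real.rpow_add_one hpos.ne']; ring_nf
      rw [e]
      have := mul_le_mul_of_nonneg_left hX (mul_nonneg hq0.le (Real.rpow_nonneg hpos.le (q - 2)))
      linarith [this]
    have hs : -1 ≤ ϖ / α - 1 := by have := div_nonneg hϖ0 hpos.le; linarith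
    have hb := one_add_mul_self_le_rpow_one_add hs hq
    rw [show 1 + (ϖ / α - 1) = ϖ / α by ring, Real.div_rpow hϖ0 hpos.le] at hb
    have hαq : 0 < α ^ q := Real.rpow_pos_of_pos hpos q
    have key : α ^ q * (1 + q * (ϖ / α - 1)) ≤ ϖ ^ q := by
      have h := mul_le_mul_of_nonneg_left hb hαq.le
      rwa [mul_div_cancel₀ _ hαq.ne'] at h
    have e2 : α ^ q * (1 + q * (ϖ / α - 1)) = α ^ q + q * α ^ (q - 1) * (ϖ - α) := by
      rw [Real.rpow_sub_one hpos.ne']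
      field_simp
    linarith [hmid, key, e2]

end TopEigLaminate

end Summit.NavierStokesRegularity.FunctionalMining

end
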